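import Mathlib.Geometry.Manifold.Instances.Sphere
import Mathlib.Geometry.Manifold.Diffeomorph
import Mathlib.AlgebraicTopology.FundamentalGroupoid.SimplyConnected
import Literature.Topology.FourManifolds.AchiralLefschetzFibration
import Literature.AlgebraicTopology.SingularHomology.SingularChains
import HarnessLib
import Literature.AlgebraicTopology.SingularHomology.ExcisionMayerVietorisProofs
import Literature.Topology.FourManifolds.HomotopyS4CompactProofs
import Literature.Topology.FourManifolds.HomotopyS4SimplyConnected
import Literature.Topology.FourManifolds.SphereSimplyConnected

/-!
# Simplified broken Lefschetz fibrations and the genus-one classification on `S⁴`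

Topic `Literature/Topology/FourManifolds`: the vocabulary of **simplified broken Lefschetz
fibrations** (SBLFs) of closed oriented smooth 4-manifolds over `S²`, after Auroux–Donaldson–
Katzarkov (broken Lefschetz fibrations), Baykur (simplified ones) and Baykur–Kamada 2015, §3:
*"First, we ask the round singular set to be connected, i.e. to consist of one circle only, and
its image on `S²` to be embedded. Second, we ask all the regular fibers to be connected. […] The
third, and the last condition we impose is to have all the Lefschetz singularities on the higher
side […]. Moreover, if the highest genus of a regular fiber in a given SBLF is `g`, we will call it
a genus `g` simplified broken Lefschetz fibration."*; Hayano 2011, Def. 2.1 (broken Lefschetz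
fibration: finitely many Lefschetz points `z₁ z₂` and a 1-dimensional round locus `Z` with the
indefinite fold model `(t, x₁, x₂, x₃) ↦ (t, x₁² + x₂² - x₃²)`, `f` injective on `Z ∪ 𝒞`) and
Def. 2.3 (simplified), together with ONE named fact: the genus-one rung of the classification —
among closed simply connected 4-manifolds with `H₂ = 0`, only `S⁴` carries a genus-1 SBLF
(Hayano 2011, Cor. 4.11; Baykur–Kamada 2015, Lemma 11 with Cor. 14).

## Main definitions

* `IsSimplifiedBrokenLefschetzFibration o f L h`: `f : X → S²` is a simplified broken Lefschetz
  fibration of the oriented smooth 4-manifold `(X, o)` with (positive) Lefschetz critical set the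
  finite set `L`, NON-EMPTY connected round locus, lower genus `h` and higher genus `h + 1`.
* `nonempty_diffeomorph_sphere_four_of_sblf_genus_one` (named fact, Hayano 2011 Cor. 4.11 in the
  case `H₂(X; ℤ) = 0`; Baykur–Kamada 2015 Lemma 11 + Cor. 14): a closed simply connected smooth
  4-manifold with `H₂(X; ℤ) = 0` admitting a genus-1 SBLF with non-empty round locus is
  diffeomorphic to `S⁴`.

## Design choices

* **Same idiom as `AchiralLefschetzFibration.lean`.**  Lefschetz points are the tree's
  `IsLefschetzCriticalPoint (𝓡 4) (𝓡 2) o f p true` (positive node `z₁ z₂` in smooth charts,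
  chirality read against `o`); the round (indefinite fold) points are given by the real normal form
  `(t, x₁, x₂, x₃) ↦ (t, x₁² + x₂² - x₃²)` in a smooth chart `φ` of `X` centred at the point and a
  smooth chart `ψ` of `S²`, both valued in the model Euclidean spaces and with smooth inverses
  (`ContMDiffOn`), exactly as Hayano 2011, Def. 2.1 (4).  Regular points are those where
  `mfderiv (𝓡 4) (𝓡 2) f` is onto (the tree's Ehresmann convention), so the round locus is the
  set of critical points off `L`.
* **Genus is read homologically**: a regular fibre `F = f ⁻¹' {y}` (a closed orientable connected
  surface) has genus `n` iff `H₁(F; ℤ) ≅ ℤ²ⁿ`, stated with the tree's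
  `Literature.AlgebraicTopology.SingularHomology.singularHomology`; no surface classification is
  invoked.  "Lower genus `h`" = every regular fibre has genus `h + 1` or `h`, both occur, and the
  regular fibres near a Lefschetz point have genus `h + 1` (Lefschetz points on the higher side).
* **The round locus is asked to be non-empty** (`IsConnected`, not `IsPreconnected`): this is the
  case "with non-empty round singular locus" of Hayano's Main Theorems / the second and fourth
  cases of Baykur–Kamada's Thm. 13; an honest Lefschetz fibration is NOT an instance.
* **No relative minimality** (Hayano's Def. 2.1 (6)) and no compactness/connectedness of `X` are
  built in; consumers add `[CompactSpace X]` etc.  The binder shape (a `Prop`-valued structure over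
  unbundled `X : Type u`, `o`, `f`, `L`, `h`) is the one in which the `SmoothPoincare4` routes
  quantify ("`X` admits an SBLF of lower genus `h`" is `∃ o f L, IsSimplifiedBrokenLefschetzFibration
  o f L h`).

Deliberately NOT here: Ehresmann / local triviality off the critical image, monodromy and Hurwitz
systems (Baykur–Kamada §2–3, Hayano §2.2–§3), the Euler-characteristic count
`e(X) = 6 - 4g + k` (Baykur 2012, Lemma 7), existence of SBLFs (Baykur, Lekili, Akbulut–Karakurt,
Williams, Baykur–Saeki), the full lists of Hayano's Main Theorem B / Baykur–Kamada's Thm. 13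
(their members `L_n`, `L'_n`, `S¹ × S³ # S` are not yet objects of the tree).

## References

* K. Hayano, *On genus-1 simplified broken Lefschetz fibrations*, Algebr. Geom. Topol. 11 (2011)
  1267–1322 (arXiv:1012.4049), Def. 2.1, Def. 2.3, Thm. 4.2, Cor. 4.11, Main Theorem B.
  [Hayano2011]
* R. İ. Baykur, S. Kamada, *Classification of broken Lefschetz fibrations with small fiber
  genera*, J. Math. Soc. Japan 67 (2015) 877–901 (arXiv:1010.5814), §3, Lemma 11, Thm. 13,
  Cor. 14. [BaykurKamada2015]
* R. İ. Baykur, *Broken Lefschetz fibrations and smooth structures on 4-manifolds*, Geom. Topol.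
  Monogr. 18 (2012) (arXiv:1205.5439), Lemma 7 and p. 18 (only `S⁴` among homotopy 4-spheres).
-/

noncomputable section

open scoped Manifold ContDiff Topology ContinuousMap
open Set Function

universe u

namespace Literature.Topology.FourManifolds

/-- **Simplified broken Lefschetz fibration with non-empty round locus, of lower genus `h`.**
`IsSimplifiedBrokenLefschetzFibration o f L h` says that the map `f : X → S²` from the oriented
smooth 4-manifold `(X, o)` to the round 2-sphere is a simplified broken Lefschetz fibration
(Baykur–Kamada 2015, §3; Hayano 2011, Def. 2.1 and Def. 2.3) whose Lefschetz critical points are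
exactly the finite set `L`, all POSITIVE, whose round (indefinite fold) locus — the critical points
off `L` — is non-empty and connected with `f` injective on the whole critical set (so the round
image is an embedded circle and critical values are distinct), whose regular fibres are connected
of genus `h + 1` or `h` (read as `H₁(fibre; ℤ) ≅ ℤ^{2(h+1)}` or `ℤ^{2h}`), both genera occurring,
and whose Lefschetz points lie on the higher-genus side.  Fields, in order: `f` is `C^∞`; `f` is
onto; every `p ∈ L` is a positive Lefschetz critical point (`IsLefschetzCriticalPoint … true`);
every critical point off `L` has an indefinite fold chart
`(t, x₁, x₂, x₃) ↦ (t, x₁² + x₂² - x₃²)` (Hayano 2011, Def. 2.1 (4)); the round locus is connected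
and non-empty; `f` is injective on the critical set (Def. 2.1 (5)); regular fibres are connected of
genus `h + 1` or `h`; a regular fibre of genus `h + 1` and one of genus `h` exist; near a Lefschetz
critical value the regular fibres have genus `h + 1` (Def. 2.3).
[cite: BaykurKamada2015, §3] -/
structure IsSimplifiedBrokenLefschetzFibration {X : Type u} [TopologicalSpace X]
    [ChartedSpace (EuclideanSpace ℝ (Fin 4)) X] [IsManifold (𝓡 4) 1 X]
    (o : SmoothOrientation (𝓡 4) X) (f : X → Metric.sphere (0 : EuclideanSpace ℝ (Fin 3)) 1)
    (L : Finset X) (h : ℕ) : Prop where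
  /-- `f` is smooth -/
  contMDiff : ContMDiff (𝓡 4) (𝓡 2) ∞ f
  /-- `f` is onto -/
  surjective : Function.Surjective f
  /-- every point of `L` is a positive Lefschetz critical point -/
  lefschetz : ∀ p ∈ L, IsLefschetzCriticalPoint (𝓡 4) (𝓡 2) o f p true
  /-- every critical point off `L` is an indefinite fold point: in smooth charts `φ` (centred at
  the point) and `ψ`, `f` is `(t, x₁, x₂, x₃) ↦ (t, x₁² + x₂² - x₃²)` -/
  fold : ∀ p : X, ¬ Function.Surjective (mfderiv (𝓡 4) (𝓡 2) f p) → p ∉ L →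
    ∃ (φ : OpenPartialHomeomorph X (EuclideanSpace ℝ (Fin 4)))
      (ψ : OpenPartialHomeomorph (Metric.sphere (0 : EuclideanSpace ℝ (Fin 3)) 1)
        (EuclideanSpace ℝ (Fin 2))),
      p ∈ φ.source ∧ φ p = 0 ∧ Set.MapsTo f φ.source ψ.source ∧
      ContMDiffOn (𝓡 4) (𝓡 4) ∞ φ φ.source ∧ ContMDiffOn (𝓡 4) (𝓡 4) ∞ φ.symm φ.target ∧
      ContMDiffOn (𝓡 2) (𝓡 2) ∞ ψ ψ.source ∧ ContMDiffOn (𝓡 2) (𝓡 2) ∞ ψ.symm ψ.target ∧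
      ∀ q ∈ φ.source, (ψ (f q)) 0 = (φ q) 0 ∧
        (ψ (f q)) 1 = (φ q) 1 ^ 2 + (φ q) 2 ^ 2 - (φ q) 3 ^ 2
  /-- the round locus (critical points off `L`) is connected and non-empty -/
  isConnected_round :
    IsConnected ({p : X | ¬ Function.Surjective (mfderiv (𝓡 4) (𝓡 2) f p)} \ (↑L : Set X))
  /-- `f` is injective on the critical set -/
  injOn_crit : Set.InjOn f {p : X | ¬ Function.Surjective (mfderiv (𝓡 4) (𝓡 2) f p)}
  /-- regular fibres are connected, of genus `h + 1` or `h` -/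
  fibre : ∀ y, (∀ q, f q = y → Function.Surjective (mfderiv (𝓡 4) (𝓡 2) f q)) →
    IsConnected (f ⁻¹' {y}) ∧
      (Nonempty ((Fin (2 * (h + 1)) → ℤ) ≃ₗ[ℤ]
          Literature.AlgebraicTopology.SingularHomology.singularHomology ℤ ℤ ↥(f ⁻¹' {y}) 1) ∨
        Nonempty ((Fin (2 * h) → ℤ) ≃ₗ[ℤ]
          Literature.AlgebraicTopology.SingularHomology.singularHomology ℤ ℤ ↥(f ⁻¹' {y}) 1))
  /-- some regular fibre has genus `h + 1` (the higher side) -/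
  exists_higher : ∃ y, (∀ q, f q = y → Function.Surjective (mfderiv (𝓡 4) (𝓡 2) f q)) ∧
    Nonempty ((Fin (2 * (h + 1)) → ℤ) ≃ₗ[ℤ]
      Literature.AlgebraicTopology.SingularHomology.singularHomology ℤ ℤ ↥(f ⁻¹' {y}) 1)
  /-- some regular fibre has genus `h` (the lower side) -/
  exists_lower : ∃ y, (∀ q, f q = y → Function.Surjective (mfderiv (𝓡 4) (𝓡 2) f q)) ∧
    Nonempty ((Fin (2 * h) → ℤ) ≃ₗ[ℤ]
      Literature.AlgebraicTopology.SingularHomology.singularHomology ℤ ℤ ↥(f ⁻¹' {y}) 1)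
  /-- the Lefschetz points lie on the higher side: regular fibres near a Lefschetz critical value
  have genus `h + 1` -/
  lefschetz_higher : ∀ p ∈ L, ∀ᶠ y in 𝓝 (f p),
    (∀ q, f q = y → Function.Surjective (mfderiv (𝓡 4) (𝓡 2) f q)) →
      Nonempty ((Fin (2 * (h + 1)) → ℤ) ≃ₗ[ℤ]
        Literature.AlgebraicTopology.SingularHomology.singularHomology ℤ ℤ ↥(f ⁻¹' {y}) 1)

namespace IsSimplifiedBrokenLefschetzFibration

variable {X : Type u} [TopologicalSpace X] [ChartedSpace (EuclideanSpace ℝ (Fin 4)) X]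
  [IsManifold (𝓡 4) 1 X] {o : SmoothOrientation (𝓡 4) X}
  {f : X → Metric.sphere (0 : EuclideanSpace ℝ (Fin 3)) 1} {L : Finset X} {h : ℕ}

/-- The round locus of an SBLF (in this file's sense) is non-empty: there is a critical point of
`f` off `L`. [folklore] -/
theorem exists_not_surjective_notMem (hf : IsSimplifiedBrokenLefschetzFibration o f L h) :
    ∃ p : X, ¬ Function.Surjective (mfderiv (𝓡 4) (𝓡 2) f p) ∧ p ∉ L := by
  obtain ⟨p, hp, hpL⟩ := hf.isConnected_round.nonempty
  exact ⟨p, hp, fun h' ↦ hpL (Finset.mem_coe.mpr h')⟩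

/-- Every Lefschetz point of an SBLF is a critical point of `f` (`dπ_p = 0`, from the node chart).
[folklore] -/
theorem not_surjective_mfderiv_of_mem
    (hf : IsSimplifiedBrokenLefschetzFibration o f L h) {p : X} (hp : p ∈ L) :
    ¬ Function.Surjective (mfderiv (𝓡 4) (𝓡 2) f p) := by
  rw [(hf.lefschetz p hp).mfderiv_eq_zero]
  intro hs
  obtain ⟨v, hv⟩ := exists_ne (0 : EuclideanSpace ℝ (Fin 2))
  obtain ⟨w, hw⟩ := hs v
  exact hv (by rw [← hw]; rfl)

end IsSimplifiedBrokenLefschetzFibration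

/-! ### The genus-one rung: only `S⁴` among homotopy 4-spheres -/

/-- **Genus-1 SBLFs on simply connected 4-manifolds with `H₂ = 0`: only `S⁴`** (named fact).
Hayano 2011, Cor. 4.11, verbatim: *"Simply connected 4-manifolds with positive definite
intersection form cannot admit any genus-1 SBLF structures except `S⁴`."* (there `M` is a closed
connected oriented smooth 4-manifold and SBLFs have non-empty round singular locus as in his Main
Theorems; the proof: by Thm. 3.11 the Hurwitz system is `S_r T(n₁,…,n_s)`; `s > 0` forces an
`S² × S²` or `S² ×~ S²` summand (Thm. 4.10), impossible for a definite form; `s = 0` puts `M` in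
the list of Thm. 4.2, `# r CP²bar`, `L # r CP²bar`, `S¹ × S³ # S # r CP²bar`, whose only simply
connected positive definite member is `S⁴`).  Independently, Baykur–Kamada 2015, Lemma 11: *"The
only closed oriented 4-manifolds admitting a genus one broken Lefschetz fibration with no Lefschetz
singularities are `S⁴`, `S² × S² # S¹ × S³`, `CP² # CP²bar # S¹ × S³`, `L_n`, and `L'_n`"*, with
Cor. 14 (`π₁ = ℤ`, resp. `ℤ_n`, `n > 1`, for the non-spherical members) and Baykur 2012, Lemma 7
(`e(X) = 6 - 4g + k`, so a genus-1 SBLF on a manifold with `e = 2` has `k = 0` Lefschetz points);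
Baykur 2012, p. 18 records the consequence that `S⁴` is the only homotopy 4-sphere of broken genus
one.  LEAN READING — the special case in which the intersection form is the zero form: for every
Hausdorff, second countable, compact, simply connected `C^∞` 4-manifold `X : Type` with
`H₂(X; ℤ) = 0` (so `Q_X = 0` is vacuously positive definite; equivalently `X` is a homotopy
4-sphere), if `X` carries a smooth orientation `o` and a genus-1 simplified broken Lefschetz
fibration `f : X → S²` with non-empty round locus (`IsSimplifiedBrokenLefschetzFibration o f L 0`
for some finite `L`), then `X` is diffeomorphic to the unit sphere `S⁴ ⊆ ℝ⁵`.  Users take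
`(h : nonempty_diffeomorph_sphere_four_of_sblf_genus_one)`.
[cite: Hayano2011, Cor. 4.11] -/
def nonempty_diffeomorph_sphere_four_of_sblf_genus_one : Prop :=
  ∀ (X : Type) [TopologicalSpace X] [T2Space X] [SecondCountableTopology X] [CompactSpace X]
    [ChartedSpace (EuclideanSpace ℝ (Fin 4)) X] [IsManifold (𝓡 4) ∞ X] [SimplyConnectedSpace X],
    CategoryTheory.Limits.IsZero
        (Literature.AlgebraicTopology.SingularHomology.singularHomology ℤ ℤ X 2) →
    (∃ (o : SmoothOrientation (𝓡 4) X) (f : X → Metric.sphere (0 : EuclideanSpace ℝ (Fin 3)) 1)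
        (L : Finset X), IsSimplifiedBrokenLefschetzFibration o f L 0) →
    Nonempty (Diffeomorph (𝓡 4) (𝓡 4) X (Metric.sphere (0 : EuclideanSpace ℝ (Fin 5)) 1) ∞)

-- TODO(general form): Hayano 2011, Cor. 4.11 for an arbitrary positive definite intersection
-- form, and the full lists of Hayano's Main Theorem B (`r ≤ 5`) / Baykur–Kamada 2015, Thm. 13,
-- once `L_n`, `L'_n`, `S¹ × S³ # S` and `# k CP²bar` are objects of the tree.

end Literature.Topology.FourManifolds

end

/-! ## Relocated from `Summits/SmoothPoincare4/SmoothPoincare4/Theorems/SblfDescentRungOne.lean` (gate, accept-time relocation of cited facts) — Baykur2012, BaykurKamada2015 -/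

namespace Literature.Topology.FourManifolds

open scoped Manifold ContDiff Topology ContinuousMap
open CategoryTheory Limits

/-- **Euler count for simplified broken Lefschetz fibrations, read on a homotopy 4-sphere: a
genus-`(h + 1)` SBLF of a homotopy 4-sphere has exactly `4h` Lefschetz points** (named fact).
Baykur 2012, Lemma 7, verbatim: *"If `X` admits a genus `g` SBLF with `k` Lefschetz
singularities, then `e(X) = 4 - 4g + k` if round locus is empty, and `e(X) = 6 - 4g + k`,
otherwise."* (proof there: with non-empty round locus `X` decomposes into `D² × Σ_{g-1}`, a round
cobordism of Euler characteristic zero, and a genus-`g` Lefschetz fibration over `D²`, which is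
`D² × Σ_g` with `k` 2-handles attached, so `e(X) = 2 - 2(g - 1) + 2 - 2g + k`).  LEAN READING —
the special case of a homotopy 4-sphere, where `e(X) = e(S⁴) = 2` (the Euler characteristic is a
homotopy invariant): for every Hausdorff second-countable `C^∞` 4-manifold `X : Type` homotopy
equivalent to the unit sphere `S⁴ ⊆ ℝ⁵` (hence closed, connected and orientable), every smooth
orientation `o` of `X`, every `f : X → S²`, finite `L ⊆ X` and `h : ℕ` such that
`IsSimplifiedBrokenLefschetzFibration o f L h` (an SBLF of genus `g = h + 1` with NON-EMPTY round
locus whose Lefschetz critical set is exactly `L`, so `k = L.card`), one has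
`2 = 6 - 4(h + 1) + L.card`, i.e. `L.card = 4 * h`.  In particular a genus-1 SBLF (`h = 0`) of a
homotopy 4-sphere has no Lefschetz points and a genus-2 one (`h = 1`) exactly four.  Users take
`(h : card_eq_four_mul_of_sblf_of_homotopyEquiv_sphere_four)`.
[cite: Baykur2012, Lemma 7] [file Topology/FourManifolds/SimplifiedBrokenLefschetzFibration] -/
def card_eq_four_mul_of_sblf_of_homotopyEquiv_sphere_four : Prop :=
  ∀ (X : Type) [TopologicalSpace X] [T2Space X] [SecondCountableTopology X]
    [ChartedSpace (EuclideanSpace ℝ (Fin 4)) X] [IsManifold (𝓡 4) ∞ X],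
    X ≃ₕ Metric.sphere (0 : EuclideanSpace ℝ (Fin 5)) 1 →
    ∀ (o : Literature.Topology.FourManifolds.SmoothOrientation (𝓡 4) X)
      (f : X → Metric.sphere (0 : EuclideanSpace ℝ (Fin 3)) 1) (L : Finset X) (h : ℕ),
      Literature.Topology.FourManifolds.IsSimplifiedBrokenLefschetzFibration o f L h →
      L.card = 4 * h

-- TODO(general form): Baykur 2012, Lemma 7 for every closed oriented 4-manifold `X`, as the
-- identity `χ(X) = 6 - 4g + k` for the tree's `Literature.AlgebraicTopology.SingularHomology.relEuler`
-- (and `χ(X) = 4 - 4g + k` when the round locus is empty).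

/-- **Genus-1 SBLFs without Lefschetz points on simply connected closed 4-manifolds: only `S⁴`**
(named fact).  Baykur–Kamada 2015, Lemma 11, verbatim: *"The only closed oriented 4-manifolds
admitting a genus one broken Lefschetz fibration with no Lefschetz singularities are `S⁴`,
`S² × S² # S¹ × S³`, `CP² # CP²bar # S¹ × S³`, `L_n`, and `L'_n`."* (their §5, case "one round
singular circle, no Lefschetz singularity"; = Thm. 13, second case: *"If round singular set is
not empty, but the set of Lefschetz critical points is, then `(X, f)` is `S² × S² # S¹ × S³`,
`CP² # CP²bar # S¹ × S³`, `S⁴`, `L_n`, or `L'_n`, `n > 1`"*), with Cor. 14: the members other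
than `S⁴` have `π₁ ≅ ℤ` (`S² × S² # S¹ × S³`, `CP² # CP²bar # S¹ × S³`) or `π₁ ≅ ℤ_n`, `n > 1`
(Pao's `L_n`, `L'_n`).  Independently Hayano 2011, Thm. 4.2 (`W_f = S_0`: total spaces `S⁴`,
`L_n`, `L'_n`, `S¹ × S³ # S`) with Rem. 4.3 (Auroux–Donaldson–Katzarkov 2005, §8.2, Example 1).
Hence a SIMPLY CONNECTED closed oriented 4-manifold carrying a genus-1 SBLF with non-empty round
locus and no Lefschetz singularity is diffeomorphic to `S⁴`.  LEAN READING: for every Hausdorff,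
second countable, compact, simply connected `C^∞` 4-manifold `X : Type`, if `X` carries a smooth
orientation `o` and a map `f : X → S²` with `IsSimplifiedBrokenLefschetzFibration o f ∅ 0` (genus
`1`, non-empty connected round locus, EMPTY Lefschetz critical set), then `X` is diffeomorphic to
the unit sphere `S⁴ ⊆ ℝ⁵`.  Compared with `nonempty_diffeomorph_sphere_four_of_sblf_genus_one`
(Hayano 2011, Cor. 4.11 at `Q_X = 0`) this is the Lefschetz-free rung: no hypothesis on `H₂(X)`,
but `L = ∅`; the Euler count `card_eq_four_mul_of_sblf_of_homotopyEquiv_sphere_four` links the two.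
Users take `(h : nonempty_diffeomorph_sphere_four_of_sblf_genus_one_noLefschetz)`.
[cite: BaykurKamada2015, Lemma 11 and Cor. 14] [file Topology/FourManifolds/SimplifiedBrokenLefschetzFibration] -/
def nonempty_diffeomorph_sphere_four_of_sblf_genus_one_noLefschetz : Prop :=
  ∀ (X : Type) [TopologicalSpace X] [T2Space X] [SecondCountableTopology X] [CompactSpace X]
    [ChartedSpace (EuclideanSpace ℝ (Fin 4)) X] [IsManifold (𝓡 4) ∞ X] [SimplyConnectedSpace X],
    (∃ (o : Literature.Topology.FourManifolds.SmoothOrientation (𝓡 4) X)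
        (f : X → Metric.sphere (0 : EuclideanSpace ℝ (Fin 3)) 1),
        Literature.Topology.FourManifolds.IsSimplifiedBrokenLefschetzFibration o f ∅ 0) →
    Nonempty (Diffeomorph (𝓡 4) (𝓡 4) X (Metric.sphere (0 : EuclideanSpace ℝ (Fin 5)) 1) ∞)

end Literature.Topology.FourManifolds
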